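import Mathlib.Analysis.Calculus.Deriv.MeanValue
import Mathlib.Analysis.SpecialFunctions.Pow.Real
import Mathlib.Analysis.SpecialFunctions.Log.Deriv
import Mathlib.Analysis.SpecialFunctions.Sqrt
import Mathlib.MeasureTheory.Integral.IntervalIntegral.Basic

/-!
# Beta / EriceFlowEnclosureCesaroTauberianRate — THE QUANTITATIVE (C,1) TAUBERIAN THEOREM AT 0⁺: A RATE FOR THE CESÀRO MEAN AND A
# LOG-LIPSCHITZ MODULUS GIVE A RATE FOR THE FUNCTION — THE SQUARE-ROOT LAW (pure [folklore] SERVICE for P2 #51c ∕ #51d; Mathlib only).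
# For Φ with Φ′ = φ on ]0, δ[:
#   * ONE SCALE (headline inequality, no limit anywhere): if `|φ u − φ t| ≤ w` on the window [t, qt] (q > 1, qt < δ) and the two Cesàro
#     means are within E₁, E₂ of m (`|Φ t∕t − m| ≤ E₁`, `|Φ(qt)∕(qt) − m| ≤ E₂`), then **`|φ t − m| ≤ w + (q·E₂ + E₁)∕(q − 1)`** (`one_scale`);
#   * LOG-LIPSCHITZ φ (`|φ u − φ t| ≤ K log(u∕t)`) with a UNIFORM Cesàro rate E on ]0, τ]: `|φ t − m| ≤ K log q + (q + 1)E∕(q − 1)` for every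
#     window (`logLip_rate`), `≤ K·h + 2E∕h + E` with q = 1 + h (`logLip_rate_step`), and at the optimal step h = √(2E∕K)
#     **THE SQUARE-ROOT LAW `|φ t − m| ≤ 2√(2KE) + E`** (`sqrt_law`);
#   * POWER RATES — THE EXPONENT HALVES: Cesàro rate `A·s^γ` ⟹ **`|φ t − m| ≤ (K + 3·2^γ·A)·t^(γ∕2)`** on an explicit ]0, τ′] (`power_rate`,
#     `isBigO_power_rate`);
#   * the ABELIAN direction loses nothing: `|φ s − m| ≤ ε s` with ε monotone ⟹ `|(1∕t)∫₀ᵗ φ − m| ≤ ε t` (`cesaro_rate_of_rate`,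
#     `cesaro_power_rate_of_power_rate`).
# The halving is SHARP (P2 #51b: V = √t·cos((√t)⁻¹) is 1-log-Lipschitz with |∫₀ᵗ V| ≤ 6t² — Cesàro exponent 1 — and V(t_n) = √t_n
# along t_n = (2πn)⁻²: exponent exactly 1∕2).
# (β-flow team, prover 2 = lower ∕ positivity side, unit `b2b-balaban-beta-bflow-p2`, gen 34; module P2 #51a; no Erice sentence occurs)

HONEST FRAMING (page 1 of everything the β sub-cell writes): discharging `BetaPertH` makes Bałaban's UV stability UNCONDITIONAL — a
real constructive-QFT result; it is NOT the continuum limit and NOT the Clay problem.  HONEST DEPENDENCY (cell reorg 2026-08-19,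
verbatim): «continuum YM on T⁴ ⇐ BetaPertH ∧ nine spine estimates (0/9 proved); BetaPertH ⇐ (D1) ∧ (D4) ∧ CAP+tail; G-an2-4 gates
asym, D1 and NE2/3/4.»  THIS MODULE DISCHARGES NOTHING and quotes nothing: [folklore] real analysis about two real functions φ, Φ — the
elementary TAUBERIAN REMAINDER estimate for Cesàro means (the remainder form of R. Schmidt's theorem; «Tauberian remainder problems»:
T. Ganelius, Tauberian Remainder Theorems, LNM 232 (1971), Ch. 1 §1.1; J. Korevaar, Tauberian Theory (2004), Ch. VII) in the form needed at
0⁺; the tree has no quantitative Tauberian theorem for Cesàro means (`lean search Tauberian|cesaro.*rate`: Karamata-type facts, P2 #50d's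
qualitative theorem, named Móricz facts only).

THE POINT.  On the window [t, qt] the derivative of Φ stays within w of φ t, so the WINDOW QUOTIENT `Q := (Φ(qt) − Φ t)∕((q − 1)t)` is within w
of φ t (Mathlib's monotonicity-from-derivative inequalities on a convex set, as in P2 #50d); and Q is an explicit combination of the two Cesàro
means, `Q − m = (q·(Φ(qt)∕(qt) − m) − (Φ t∕t − m))∕(q − 1)`.  Everything else is bookkeeping: a log-Lipschitz φ has w = K log q ≤ K(q − 1);
with q = 1 + h the bound `K h + 2E∕h + E` is optimised at h = √(2E∕K); with the Cesàro rate A s^γ on ]0, 2t] and the step h = t^(γ∕2) the three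
terms are `K t^(γ∕2) + 2·2^γ A t^(γ∕2) + 2^γ A t^γ`.  The Abelian direction is `|∫₀ᵗ (φ − m)| ≤ t·ε t`.

WHAT THIS FILE PROVES (0 sorry, 0 def): §1 `window_quotient_ge`, `window_quotient_le`, `window_quotient_abs`, `window_quotient_sub`, HEADLINE
**`one_scale`**; §2 **`logLip_rate`**, `logLip_rate_step`, **`sqrt_law`**, `logLip_of_deriv_abs_le` (the modulus from `|φ′| ≤ K∕v`); §3
**`power_rate`**, `isBigO_power_rate`; §4 `cesaro_rate_of_rate`, `cesaro_power_rate_of_power_rate`.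
NOT CLAIMED: log-HÖLDER moduli (exponent α∕(1 + α) instead of 1∕2 — same proof, not needed downstream); one-sided (slow-decrease) remainder
forms; other means (logarithmic, Abel); anything about β-functions (the consumer P2 #51c instantiates φ = r∕u²); `BetaPertH`; continuum; Clay.
-/

namespace Summit.QuantumFields.BalabanUV.Beta.EriceFlowEnclosureCesaroTauberianRate

open Set Filter Topology MeasureTheory Asymptotics

noncomputable section

/-! ## §1 One scale: the window quotient is within the oscillation of φ t and is a combination of two Cesàro means -/

section Window

variable {Φ φ : ℝ → ℝ} {δ : ℝ}

/-- LOWER window inequality: if `Φ′ = φ` on ]0, δ[ and `φ t − w ≤ φ u` on the window [t, qt] ⊆ ]0, δ[ (q > 1), then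
`φ t − w ≤ (Φ(qt) − Φ t)∕((q − 1)t)` (monotonicity from the derivative on the convex set [t, qt]). [folklore] -/
theorem window_quotient_ge (hΦ : ∀ t ∈ Ioo 0 δ, HasDerivAt Φ (φ t) t) {t q w : ℝ}
    (ht : 0 < t) (hq : 1 < q) (hqt : q * t < δ) (hw : ∀ u ∈ Icc t (q * t), φ t - w ≤ φ u) :
    φ t - w ≤ (Φ (q * t) - Φ t) / ((q - 1) * t) := by
  have htq : t ≤ q * t := by nlinarith
  have hcont : ContinuousOn Φ (Icc t (q * t)) := fun x hx =>
    (hΦ x ⟨ht.trans_le hx.1, hx.2.trans_lt hqt⟩).continuousAt.continuousWithinAt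
  have hdiff : DifferentiableOn ℝ Φ (interior (Icc t (q * t))) := by
    intro x hx
    rw [interior_Icc] at hx
    exact (hΦ x ⟨ht.trans hx.1, hx.2.trans hqt⟩).differentiableAt.differentiableWithinAt
  have hbound : ∀ x ∈ interior (Icc t (q * t)), φ t - w ≤ deriv Φ x := by
    intro x hx
    rw [interior_Icc] at hx
    rw [(hΦ x ⟨ht.trans hx.1, hx.2.trans hqt⟩).deriv]
    exact hw x ⟨hx.1.le, hx.2.le⟩
  have hmv := Convex.mul_sub_le_image_sub_of_le_deriv (convex_Icc t (q * t)) hcont hdiff hbound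
    t (left_mem_Icc.mpr htq) (q * t) (right_mem_Icc.mpr htq) htq
  have hden : 0 < (q - 1) * t := mul_pos (sub_pos.mpr hq) ht
  rw [le_div_iff₀ hden]
  calc (φ t - w) * ((q - 1) * t) = (φ t - w) * (q * t - t) := by ring
    _ ≤ Φ (q * t) - Φ t := hmv

/-- UPPER window inequality: if `Φ′ = φ` on ]0, δ[ and `φ u ≤ φ t + w` on the window [t, qt] ⊆ ]0, δ[ (q > 1), then
`(Φ(qt) − Φ t)∕((q − 1)t) ≤ φ t + w`. [folklore] -/
theorem window_quotient_le (hΦ : ∀ t ∈ Ioo 0 δ, HasDerivAt Φ (φ t) t) {t q w : ℝ}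
    (ht : 0 < t) (hq : 1 < q) (hqt : q * t < δ) (hw : ∀ u ∈ Icc t (q * t), φ u ≤ φ t + w) :
    (Φ (q * t) - Φ t) / ((q - 1) * t) ≤ φ t + w := by
  have htq : t ≤ q * t := by nlinarith
  have hcont : ContinuousOn Φ (Icc t (q * t)) := fun x hx =>
    (hΦ x ⟨ht.trans_le hx.1, hx.2.trans_lt hqt⟩).continuousAt.continuousWithinAt
  have hdiff : DifferentiableOn ℝ Φ (interior (Icc t (q * t))) := by
    intro x hx
    rw [interior_Icc] at hx
    exact (hΦ x ⟨ht.trans hx.1, hx.2.trans hqt⟩).differentiableAt.differentiableWithinAt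
  have hbound : ∀ x ∈ interior (Icc t (q * t)), deriv Φ x ≤ φ t + w := by
    intro x hx
    rw [interior_Icc] at hx
    rw [(hΦ x ⟨ht.trans hx.1, hx.2.trans hqt⟩).deriv]
    exact hw x ⟨hx.1.le, hx.2.le⟩
  have hmv := Convex.image_sub_le_mul_sub_of_deriv_le (convex_Icc t (q * t)) hcont hdiff hbound
    t (left_mem_Icc.mpr htq) (q * t) (right_mem_Icc.mpr htq) htq
  have hden : 0 < (q - 1) * t := mul_pos (sub_pos.mpr hq) ht
  rw [div_le_iff₀ hden]
  calc Φ (q * t) - Φ t ≤ (φ t + w) * (q * t - t) := hmv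
    _ = (φ t + w) * ((q - 1) * t) := by ring

/-- TWO-SIDED window inequality: if `|φ u − φ t| ≤ w` on [t, qt] ⊆ ]0, δ[ then the window quotient is within w of φ t:
`|φ t − (Φ(qt) − Φ t)∕((q − 1)t)| ≤ w`. [folklore] -/
theorem window_quotient_abs (hΦ : ∀ t ∈ Ioo 0 δ, HasDerivAt Φ (φ t) t) {t q w : ℝ}
    (ht : 0 < t) (hq : 1 < q) (hqt : q * t < δ) (hw : ∀ u ∈ Icc t (q * t), |φ u - φ t| ≤ w) :
    |φ t - (Φ (q * t) - Φ t) / ((q - 1) * t)| ≤ w := by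
  have h1 := window_quotient_ge hΦ ht hq hqt (w := w) fun u hu => by
    have := (abs_le.mp (hw u hu)).1
    linarith
  have h2 := window_quotient_le hΦ ht hq hqt (w := w) fun u hu => by
    have := (abs_le.mp (hw u hu)).2
    linarith
  rw [abs_le]
  constructor <;> linarith

end Window

/-- ALGEBRA: the window quotient is an explicit combination of the two Cesàro means,
`(Φ(qt) − Φ t)∕((q − 1)t) − m = (q·(Φ(qt)∕(qt) − m) − (Φ t∕t − m))∕(q − 1)` (t ≠ 0, q ≠ 0, q ≠ 1). [folklore] -/
theorem window_quotient_sub (Φ : ℝ → ℝ) {t q : ℝ} (ht : t ≠ 0) (hq0 : q ≠ 0) (hq1 : q ≠ 1) (m : ℝ) :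
    (Φ (q * t) - Φ t) / ((q - 1) * t) - m = (q * (Φ (q * t) / (q * t) - m) - (Φ t / t - m)) / (q - 1) := by
  have hq1' : q - 1 ≠ 0 := sub_ne_zero.mpr hq1
  field_simp
  ring

/-- **THE ONE-SCALE TAUBERIAN INEQUALITY (HEADLINE; no limit anywhere).**  If `Φ′ = φ` on ]0, δ[, `|φ u − φ t| ≤ w` on the window [t, qt]
(q > 1, qt < δ), and the two Cesàro means satisfy `|Φ t∕t − m| ≤ E₁`, `|Φ(qt)∕(qt) − m| ≤ E₂`, then
**`|φ t − m| ≤ w + (q·E₂ + E₁)∕(q − 1)`**.  Letting w, E₁, E₂ → 0 along t → 0⁺ for a fixed q is P2 #50d's qualitative theorem; keeping them is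
the remainder form. [folklore] (remainder form of R. Schmidt's (C,1) Tauberian theorem; Ganelius, LNM 232, Ch. 1) -/
theorem one_scale {Φ φ : ℝ → ℝ} {δ : ℝ} (hΦ : ∀ t ∈ Ioo 0 δ, HasDerivAt Φ (φ t) t) {t q w E₁ E₂ m : ℝ}
    (ht : 0 < t) (hq : 1 < q) (hqt : q * t < δ) (hw : ∀ u ∈ Icc t (q * t), |φ u - φ t| ≤ w)
    (hE₁ : |Φ t / t - m| ≤ E₁) (hE₂ : |Φ (q * t) / (q * t) - m| ≤ E₂) :
    |φ t - m| ≤ w + (q * E₂ + E₁) / (q - 1) := by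
  have hQ := window_quotient_abs hΦ ht hq hqt hw
  have hq0 : 0 < q := by linarith
  have hq1 : 0 < q - 1 := sub_pos.mpr hq
  have hq1' : 0 ≤ q - 1 := hq1.le
  have heq := window_quotient_sub Φ ht.ne' hq0.ne' (ne_of_gt hq) m
  have hQm : |(Φ (q * t) - Φ t) / ((q - 1) * t) - m| ≤ (q * E₂ + E₁) / (q - 1) := by
    rw [heq, abs_div, abs_of_pos hq1]
    have hnum : |q * (Φ (q * t) / (q * t) - m) - (Φ t / t - m)| ≤ q * E₂ + E₁ := by
      calc |q * (Φ (q * t) / (q * t) - m) - (Φ t / t - m)|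
          ≤ |q * (Φ (q * t) / (q * t) - m)| + |Φ t / t - m| := abs_sub _ _
        _ = q * |Φ (q * t) / (q * t) - m| + |Φ t / t - m| := by rw [abs_mul, abs_of_pos hq0]
        _ ≤ q * E₂ + E₁ := add_le_add (mul_le_mul_of_nonneg_left hE₂ hq0.le) hE₁
    exact div_le_div_of_nonneg_right hnum hq1'
  calc |φ t - m| = |(φ t - (Φ (q * t) - Φ t) / ((q - 1) * t)) + ((Φ (q * t) - Φ t) / ((q - 1) * t) - m)| := by
        congr 1; ring
    _ ≤ |φ t - (Φ (q * t) - Φ t) / ((q - 1) * t)| + |(Φ (q * t) - Φ t) / ((q - 1) * t) - m| := abs_add_le _ _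
    _ ≤ w + (q * E₂ + E₁) / (q - 1) := add_le_add hQ hQm

/-! ## §2 Log-Lipschitz φ with a uniform Cesàro rate: every window, the free step, and the square-root law -/

section LogLip

variable {Φ φ : ℝ → ℝ} {δ K τ E m : ℝ}

/-- **LOG-LIPSCHITZ φ, UNIFORM CESÀRO RATE, ANY WINDOW.**  If `Φ′ = φ` on ]0, δ[, `|φ u − φ t| ≤ K·log(u∕t)` for `0 < t ≤ u < δ` (K ≥ 0) and
`|Φ s∕s − m| ≤ E` for all s ∈ ]0, τ], then for every q > 1 and t > 0 with `qt ≤ τ`, `qt < δ`: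
**`|φ t − m| ≤ K·log q + (q + 1)·E∕(q − 1)`** (`one_scale` with w = K log q, E₁ = E₂ = E). [folklore] -/
theorem logLip_rate (hΦ : ∀ t ∈ Ioo 0 δ, HasDerivAt Φ (φ t) t) (hK : 0 ≤ K)
    (hlip : ∀ t u : ℝ, 0 < t → t ≤ u → u < δ → |φ u - φ t| ≤ K * Real.log (u / t))
    (hE : ∀ s ∈ Ioc 0 τ, |Φ s / s - m| ≤ E)
    {t q : ℝ} (ht : 0 < t) (hq : 1 < q) (hqτ : q * t ≤ τ) (hqδ : q * t < δ) :
    |φ t - m| ≤ K * Real.log q + (q + 1) * E / (q - 1) := by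
  have hq0 : 0 < q := by linarith
  have htq : t ≤ q * t := by nlinarith
  have hw : ∀ u ∈ Icc t (q * t), |φ u - φ t| ≤ K * Real.log q := by
    intro u hu
    have h1 := hlip t u ht hu.1 (hu.2.trans_lt hqδ)
    have hut0 : 0 < u / t := div_pos (ht.trans_le hu.1) ht
    have hut : u / t ≤ q := by rw [div_le_iff₀ ht]; exact hu.2
    calc |φ u - φ t| ≤ K * Real.log (u / t) := h1
      _ ≤ K * Real.log q := mul_le_mul_of_nonneg_left (Real.log_le_log hut0 hut) hK
  have hE₁ := hE t ⟨ht, htq.trans hqτ⟩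
  have hE₂ := hE (q * t) ⟨by positivity, hqτ⟩
  have h := one_scale hΦ ht hq hqδ hw hE₁ hE₂
  calc |φ t - m| ≤ K * Real.log q + (q * E + E) / (q - 1) := h
    _ = K * Real.log q + (q + 1) * E / (q - 1) := by ring

/-- **THE FREE STEP**: with q = 1 + h (h > 0; `log(1 + h) ≤ h`), under the hypotheses of `logLip_rate`:
**`|φ t − m| ≤ K·h + 2E∕h + E`** whenever `(1 + h)t ≤ τ` and `(1 + h)t < δ`. [folklore] -/
theorem logLip_rate_step (hΦ : ∀ t ∈ Ioo 0 δ, HasDerivAt Φ (φ t) t) (hK : 0 ≤ K)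
    (hlip : ∀ t u : ℝ, 0 < t → t ≤ u → u < δ → |φ u - φ t| ≤ K * Real.log (u / t))
    (hE : ∀ s ∈ Ioc 0 τ, |Φ s / s - m| ≤ E)
    {t h : ℝ} (ht : 0 < t) (hh : 0 < h) (hhτ : (1 + h) * t ≤ τ) (hhδ : (1 + h) * t < δ) :
    |φ t - m| ≤ K * h + 2 * E / h + E := by
  have hq : 1 < 1 + h := by linarith
  have h1 := logLip_rate hΦ hK hlip hE ht hq hhτ hhδ
  have hlog : Real.log (1 + h) ≤ h := by
    have := Real.log_le_sub_one_of_pos (by linarith : 0 < 1 + h)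
    linarith
  have e : (1 + h + 1) * E / (1 + h - 1) = 2 * E / h + E := by
    have hh' : h ≠ 0 := hh.ne'
    rw [show (1 + h - 1) = h by ring, show (1 + h + 1) * E = 2 * E + h * E by ring, add_div, mul_div_cancel_left₀ E hh']
  calc |φ t - m| ≤ K * Real.log (1 + h) + (1 + h + 1) * E / (1 + h - 1) := h1
    _ ≤ K * h + (1 + h + 1) * E / (1 + h - 1) := by
        have := mul_le_mul_of_nonneg_left hlog hK
        linarith
    _ = K * h + 2 * E / h + E := by rw [e]; ring

/-- **THE SQUARE-ROOT LAW (HEADLINE of §2).**  If `Φ′ = φ` on ]0, δ[, φ is log-Lipschitz with constant K > 0 below δ, and the Cesàro means have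
the UNIFORM rate `|Φ s∕s − m| ≤ E` on ]0, τ] (E > 0), then at the optimal step h = √(2E∕K):
**`|φ t − m| ≤ 2·√(2·K·E) + E`** for every t > 0 with `(1 + √(2E∕K))·t ≤ τ` and `(1 + √(2E∕K))·t < δ` — the rate of φ is the SQUARE ROOT of
the rate of its Cesàro mean (times the modulus constant), and P2 #51b shows the square root cannot be removed. [folklore]
(Tauberian remainder theorem for (C,1), elementary case; Ganelius, LNM 232, Ch. 1; Korevaar, Tauberian Theory, Ch. VII) -/
theorem sqrt_law (hΦ : ∀ t ∈ Ioo 0 δ, HasDerivAt Φ (φ t) t) (hK : 0 < K)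
    (hlip : ∀ t u : ℝ, 0 < t → t ≤ u → u < δ → |φ u - φ t| ≤ K * Real.log (u / t))
    (hE : ∀ s ∈ Ioc 0 τ, |Φ s / s - m| ≤ E) (hE0 : 0 < E)
    {t : ℝ} (ht : 0 < t) (hhτ : (1 + Real.sqrt (2 * E / K)) * t ≤ τ) (hhδ : (1 + Real.sqrt (2 * E / K)) * t < δ) :
    |φ t - m| ≤ 2 * Real.sqrt (2 * K * E) + E := by
  set h : ℝ := Real.sqrt (2 * E / K) with hh_def
  have harg : 0 < 2 * E / K := by positivity
  have hh : 0 < h := Real.sqrt_pos.mpr harg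
  have hh2 : h ^ 2 = 2 * E / K := Real.sq_sqrt harg.le
  have h1 := logLip_rate_step hΦ hK.le hlip hE ht hh hhτ hhδ
  -- K·h = √(2KE) and 2E∕h = K·h
  have hKh : K * h = Real.sqrt (2 * K * E) := by
    have hKK : Real.sqrt (K * K) = K := Real.sqrt_mul_self hK.le
    calc K * h = Real.sqrt (K * K) * Real.sqrt (2 * E / K) := by rw [hKK]
      _ = Real.sqrt (K * K * (2 * E / K)) := (Real.sqrt_mul (mul_nonneg hK.le hK.le) _).symm
      _ = Real.sqrt (2 * K * E) := by
          congr 1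
          field_simp
  have h2Eh : 2 * E / h = K * h := by
    rw [div_eq_iff hh.ne']
    calc 2 * E = K * (2 * E / K) := by field_simp
      _ = K * h ^ 2 := by rw [hh2]
      _ = K * h * h := by ring
  calc |φ t - m| ≤ K * h + 2 * E / h + E := h1
    _ = 2 * Real.sqrt (2 * K * E) + E := by rw [h2Eh, hKh]; ring

/-- **A DERIVATIVE BOUND `|φ′(v)| ≤ K∕v` MAKES φ LOG-LIPSCHITZ WITH CONSTANT K**: if φ has derivative φd v at every v ∈ ]0, δ[ with
`|φd v| ≤ K∕v`, then `|φ u − φ t| ≤ K·log(u∕t)` for `0 < t ≤ u < δ` (the functions `K·log ∓ φ` have derivative `K∕v ∓ φd v ≥ 0` on [t, u],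
hence are monotone — Mathlib's monotonicity from the derivative on a convex set).  The form in which P2 #51b ∕ #51c verify the modulus. [folklore] -/
theorem logLip_of_deriv_abs_le {φd : ℝ → ℝ} (hφ : ∀ v ∈ Ioo 0 δ, HasDerivAt φ (φd v) v)
    (hb : ∀ v ∈ Ioo 0 δ, |φd v| ≤ K / v) :
    ∀ t u : ℝ, 0 < t → t ≤ u → u < δ → |φ u - φ t| ≤ K * Real.log (u / t) := by
  intro t u ht htu huδ
  have hu0 : 0 < u := ht.trans_le htu
  rw [Real.log_div hu0.ne' ht.ne', mul_sub]
  have key : ∀ σ : ℝ, σ = 1 ∨ σ = -1 → σ * (φ u - φ t) ≤ K * Real.log u - K * Real.log t := by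
    intro σ hσ
    have hσ1 : |σ| ≤ 1 := by rcases hσ with h | h <;> simp [h]
    have hg : ∀ v ∈ Icc t u, HasDerivAt (fun w : ℝ => K * Real.log w - σ * φ w) (K * v⁻¹ - σ * φd v) v :=
      fun v hv => ((Real.hasDerivAt_log (ht.trans_le hv.1).ne').const_mul K).sub
        ((hφ v ⟨ht.trans_le hv.1, hv.2.trans_lt huδ⟩).const_mul σ)
    have hcont : ContinuousOn (fun w : ℝ => K * Real.log w - σ * φ w) (Icc t u) :=
      fun v hv => (hg v hv).continuousAt.continuousWithinAt
    have hdiff : DifferentiableOn ℝ (fun w : ℝ => K * Real.log w - σ * φ w) (interior (Icc t u)) := by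
      intro v hv
      rw [interior_Icc] at hv
      exact (hg v ⟨hv.1.le, hv.2.le⟩).differentiableAt.differentiableWithinAt
    have hnonneg : ∀ v ∈ interior (Icc t u), 0 ≤ deriv (fun w : ℝ => K * Real.log w - σ * φ w) v := by
      intro v hv
      rw [interior_Icc] at hv
      have hv0 : 0 < v := ht.trans hv.1
      rw [(hg v ⟨hv.1.le, hv.2.le⟩).deriv]
      have h1 : |σ * φd v| ≤ K / v := by
        rw [abs_mul]
        calc |σ| * |φd v| ≤ 1 * (K / v) := mul_le_mul hσ1 (hb v ⟨hv0, hv.2.trans huδ⟩) (abs_nonneg _) zero_le_one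
          _ = K / v := one_mul _
      have h2 := (abs_le.mp h1).2
      rw [div_eq_mul_inv] at h2
      linarith
    have hmono := Convex.mul_sub_le_image_sub_of_le_deriv (convex_Icc t u) hcont hdiff hnonneg
      t (left_mem_Icc.mpr htu) u (right_mem_Icc.mpr htu) htu
    simp only [zero_mul] at hmono
    linarith
  rw [abs_le]
  constructor
  · have := key (-1) (Or.inr rfl); linarith
  · have := key 1 (Or.inl rfl); linarith

end LogLip

/-! ## §3 Power rates: the exponent halves -/

section Power

variable {Φ φ : ℝ → ℝ} {δ K τ A γ m : ℝ}

/-- **POWER RATES — THE EXPONENT HALVES (HEADLINE of §3).**  If `Φ′ = φ` on ]0, δ[, φ is log-Lipschitz with constant K ≥ 0 below δ,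
and the Cesàro means have the POWER rate `|Φ s∕s − m| ≤ A·s^γ` on ]0, τ] (A ≥ 0, γ > 0), then on the explicit range
`0 < t ≤ τ′ := min 1 (min (τ∕2) (δ∕4))`: **`|φ t − m| ≤ (K + 3·2^γ·A)·t^(γ∕2)`** (`logLip_rate_step` with the step h = t^(γ∕2) ≤ 1 and the
uniform rate A(2t)^γ on the window ]0, (1 + h)t] ⊆ ]0, 2t]). [folklore] -/
theorem power_rate (hΦ : ∀ t ∈ Ioo 0 δ, HasDerivAt Φ (φ t) t) (hK : 0 ≤ K)
    (hlip : ∀ t u : ℝ, 0 < t → t ≤ u → u < δ → |φ u - φ t| ≤ K * Real.log (u / t))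
    (hA : 0 ≤ A) (hγ : 0 < γ) (hE : ∀ s ∈ Ioc 0 τ, |Φ s / s - m| ≤ A * s ^ γ) :
    ∀ t ∈ Ioc 0 (min 1 (min (τ / 2) (δ / 4))), |φ t - m| ≤ (K + 3 * 2 ^ γ * A) * t ^ (γ / 2) := by
  intro t ht
  have ht0 : 0 < t := ht.1
  have ht1 : t ≤ 1 := ht.2.trans (min_le_left _ _)
  have htτ : t ≤ τ / 2 := ht.2.trans ((min_le_right _ _).trans (min_le_left _ _))
  have htδ : t ≤ δ / 4 := ht.2.trans ((min_le_right _ _).trans (min_le_right _ _))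
  -- the step h = t^(γ∕2) ∈ ]0, 1]
  set h : ℝ := t ^ (γ / 2) with hh_def
  have hh0 : 0 < h := Real.rpow_pos_of_pos ht0 _
  have hh1 : h ≤ 1 := Real.rpow_le_one ht0.le ht1 (by positivity)
  have hwin : (1 + h) * t ≤ 2 * t := by nlinarith
  have hhτ : (1 + h) * t ≤ 2 * t := hwin
  -- uniform Cesàro rate E := A (2t)^γ on ]0, 2t]
  have h2t : 0 < 2 * t := by positivity
  have hE : ∀ s ∈ Ioc 0 (2 * t), |Φ s / s - m| ≤ A * (2 * t) ^ γ := by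
    intro s hs
    have hsτ : s ∈ Ioc 0 τ := ⟨hs.1, hs.2.trans (by linarith)⟩
    calc |Φ s / s - m| ≤ A * s ^ γ := hE s hsτ
      _ ≤ A * (2 * t) ^ γ := mul_le_mul_of_nonneg_left (Real.rpow_le_rpow hs.1.le hs.2 hγ.le) hA
  have hstep := logLip_rate_step hΦ hK hlip hE ht0 hh0 hhτ (by linarith)
  -- bookkeeping: (2t)^γ = 2^γ t^γ, t^γ∕h = h, t^γ ≤ h
  have h2γ : (2 * t) ^ γ = 2 ^ γ * t ^ γ := Real.mul_rpow (by norm_num) ht0.le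
  have htγh : t ^ γ / h = h := by
    rw [hh_def, ← Real.rpow_sub ht0]
    congr 1
    ring
  have htγle : t ^ γ ≤ h := by
    rw [hh_def]
    exact Real.rpow_le_rpow_of_exponent_ge ht0 ht1 (by linarith)
  have h2pos : 0 < (2:ℝ) ^ γ := Real.rpow_pos_of_pos (by norm_num) _
  have e1 : 2 * (A * (2 * t) ^ γ) / h = 2 * 2 ^ γ * A * h := by
    rw [h2γ]
    calc 2 * (A * (2 ^ γ * t ^ γ)) / h = 2 * 2 ^ γ * A * (t ^ γ / h) := by ring
      _ = 2 * 2 ^ γ * A * h := by rw [htγh]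
  have e2 : A * (2 * t) ^ γ ≤ 2 ^ γ * A * h := by
    rw [h2γ]
    calc A * (2 ^ γ * t ^ γ) = 2 ^ γ * A * t ^ γ := by ring
      _ ≤ 2 ^ γ * A * h := mul_le_mul_of_nonneg_left htγle (by positivity)
  calc |φ t - m| ≤ K * h + 2 * (A * (2 * t) ^ γ) / h + A * (2 * t) ^ γ := hstep
    _ ≤ K * h + 2 * 2 ^ γ * A * h + 2 ^ γ * A * h := by rw [e1]; linarith
    _ = (K + 3 * 2 ^ γ * A) * h := by ring

/-- **THE EXPONENT HALVES, in Landau notation**: `Φ′ = φ` on ]0, δ[ (δ > 0), φ log-Lipschitz below δ, and `Φ t∕t − m = O(t^γ)` at 0⁺ (γ > 0)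
⟹ **`φ t − m = O(t^(γ∕2))` at 0⁺**. [folklore] -/
theorem isBigO_power_rate (hδ : 0 < δ) (hΦ : ∀ t ∈ Ioo 0 δ, HasDerivAt Φ (φ t) t) (hK : 0 ≤ K)
    (hlip : ∀ t u : ℝ, 0 < t → t ≤ u → u < δ → |φ u - φ t| ≤ K * Real.log (u / t)) (hγ : 0 < γ)
    (hO : (fun t => Φ t / t - m) =O[𝓝[>] 0] (fun t => t ^ γ)) :
    (fun t => φ t - m) =O[𝓝[>] 0] (fun t => t ^ (γ / 2)) := by
  obtain ⟨c, hc0, hc⟩ := hO.exists_nonneg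
  rw [IsBigOWith] at hc
  obtain ⟨τ, hτ, hb⟩ := (nhdsGT_basis (0:ℝ)).eventually_iff.mp hc
  -- uniform power rate on ]0, τ∕2]
  have hE : ∀ s ∈ Ioc 0 (τ / 2), |Φ s / s - m| ≤ c * s ^ γ := by
    intro s hs
    have h := hb ⟨hs.1, hs.2.trans_lt (by linarith)⟩
    rw [Real.norm_eq_abs, Real.norm_eq_abs, abs_of_nonneg (Real.rpow_nonneg hs.1.le _)] at h
    exact h
  have hrate := power_rate hΦ hK hlip hc0 hγ hE
  refine IsBigO.of_bound (K + 3 * 2 ^ γ * c) ?_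
  have hpos : 0 < min 1 (min (τ / 2 / 2) (δ / 4)) := lt_min one_pos (lt_min (by positivity) (by positivity))
  filter_upwards [Ioo_mem_nhdsGT hpos] with t ht
  rw [Real.norm_eq_abs, Real.norm_eq_abs, abs_of_nonneg (Real.rpow_nonneg ht.1.le _)]
  exact hrate t ⟨ht.1, ht.2.le⟩

end Power

/-! ## §4 The Abelian direction loses nothing -/

/-- **A RATE FOR φ IS A RATE FOR ITS CESÀRO MEAN (no loss).**  If φ is interval-integrable on [0, t] for t ∈ ]0, δ], `|φ s − m| ≤ ε s` on ]0, δ]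
and ε is monotone on ]0, δ], then **`|(1∕t)∫₀ᵗ φ − m| ≤ ε t`** for every t ∈ ]0, δ] (`|∫₀ᵗ(φ − m)| ≤ t·ε t`). [folklore] -/
theorem cesaro_rate_of_rate {φ ε : ℝ → ℝ} {δ m : ℝ}
    (hint : ∀ t ∈ Ioc 0 δ, IntervalIntegrable φ volume 0 t)
    (hε : MonotoneOn ε (Ioc 0 δ)) (hb : ∀ s ∈ Ioc 0 δ, |φ s - m| ≤ ε s) :
    ∀ t ∈ Ioc 0 δ, |(∫ v in (0:ℝ)..t, φ v) / t - m| ≤ ε t := by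
  intro t ht
  have ht0 : 0 < t := ht.1
  have hI := hint t ht
  have e : (∫ v in (0:ℝ)..t, φ v) / t - m = (∫ v in (0:ℝ)..t, (φ v - m)) / t := by
    rw [intervalIntegral.integral_sub hI intervalIntegrable_const, intervalIntegral.integral_const, smul_eq_mul, sub_zero]
    field_simp
  rw [e, abs_div, abs_of_pos ht0, div_le_iff₀ ht0]
  have h := intervalIntegral.norm_integral_le_of_norm_le_const (a := 0) (b := t) (C := ε t) (f := fun v => φ v - m)
    fun v hv => by
      rw [uIoc_of_le ht0.le] at hv
      have hv' : v ∈ Ioc 0 δ := ⟨hv.1, hv.2.trans ht.2⟩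
      rw [Real.norm_eq_abs]
      exact (hb v hv').trans (hε hv' ht hv.2)
  rw [Real.norm_eq_abs, sub_zero, abs_of_pos ht0] at h
  exact h

/-- **POWER RATES TRANSPORT TO THE CESÀRO MEAN WITH THE SAME EXPONENT**: `|φ s − m| ≤ A·s^γ` on ]0, δ] (A ≥ 0, γ ≥ 0), φ interval-integrable
⟹ `|(1∕t)∫₀ᵗ φ − m| ≤ A·t^γ` on ]0, δ].  With §3: CESÀRO EXPONENT γ ⟹ EXPONENT γ∕2 FOR φ ⟹ CESÀRO EXPONENT γ∕2 — the loss sits entirely in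
the Tauberian direction, and P2 #51b shows it is incurred. [folklore] -/
theorem cesaro_power_rate_of_power_rate {φ : ℝ → ℝ} {δ m A γ : ℝ}
    (hint : ∀ t ∈ Ioc 0 δ, IntervalIntegrable φ volume 0 t) (hA : 0 ≤ A) (hγ : 0 ≤ γ)
    (hb : ∀ s ∈ Ioc 0 δ, |φ s - m| ≤ A * s ^ γ) :
    ∀ t ∈ Ioc 0 δ, |(∫ v in (0:ℝ)..t, φ v) / t - m| ≤ A * t ^ γ := by
  refine cesaro_rate_of_rate (ε := fun s => A * s ^ γ) hint ?_ hb
  intro a ha b hb' hab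
  exact mul_le_mul_of_nonneg_left (Real.rpow_le_rpow ha.1.le hab hγ) hA

end

end Summit.QuantumFields.BalabanUV.Beta.EriceFlowEnclosureCesaroTauberianRate
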